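import Summits.QuantumFields.BalabanUV.T4Continuum.Spine.NE1p.DressedRebornMuPartSeparableWitness

/-!
# T⁴ programme, spine estimate NE1′ (node O3b/H2) — WITNESS «THE RE-BORN μ-PART FIRES ON A SEPARABLE TWO-DOMAIN DATUM», PART 2 of 2:
# the activity is ADDITIVELY SEPARABLE along the bi-pencil — its mixed difference VANISHES IDENTICALLY —, yet the END's bounded mixed
# difference of the cluster logarithm is NOT zero: the re-born μ-part is carried ENTIRELY by the non-linearity of `E = log(1 + w)`

Cell `pub-balaban`, sub-cell `t4`, row NE1′ formalisation crew (`t4/formal/NE1p/LEAVES.md` row **W87 ∕ DAG N29zzzzu**; INTENT `HOME/CLAIMS.log` l.23711,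
RULINGS R-T142 l.23746 (provisional) ∕ R-T149 l.24193 (FIRM, caps 360∕280); read X225), unit
`b2b-balaban-t4-ne1p-formalise-leaf-09` (gen 14).  PART 2 of 2 — imports PART 1 `Spine/NE1p/DressedRebornMuPartSeparableWitness` ONLY and
re-enters its namespace; THEOREMS ONLY (0 def, 0 `def … : Prop`, 0 cite, 0 sorry, 0 `attribute`); W41's `closedForm_real_sub_zero`∕`norm_term_le`,
W33's `incr`∕`integral_incr_pos`, W35's `cM`∕`cM_pos`, W24's `exp_locE_cube`∕`dressedConst_le_one`∕`X₀`∕`eq_X₀_iff` are used BY NAME — nothing restated.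

* §6 THE TWO TERMS IN CLOSED FORM along `0 + μ • tab 0 + s • v_B`: the core at `0` reads `μ` ONLY, the core at `1` reads `s` ONLY
  (`readOut_coreAt_zero_bipencil`, `readOut_coreAt_one_bipencil`; `termAt_coreAt_zero_bipencil`∕`_one_`: W41's integrand family
  `∫ e^{τ·r·e^{−(v 0)²}}·e^{−‖v‖²} dv` at `τ = μ` resp. `τ = s∕2`); `actB_X₀` and `actB_of_ne`;
* §7 **`actB_mixedDiff_eq_zero`** — at EVERY polymer and for EVERY two sources `μ, μ′` and contents `s, s′`:
  `act(μ,s) − act(μ′,s) − (act(μ,s′) − act(μ′,s′)) = 0`; the increments `actB_source_incr` (`= (cM r∕2)·∫incr(t·r)`, real source `t`) and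
  `actB_content_incr` (`= (cM r∕2)·∫incr(r∕2)`); **`crossDefect_eq`**: `(1 + w(μ,s))(1 + w(μ′,s′)) − (1 + w(μ′,s))(1 + w(μ,s′)) =
  (w(μ,s) − w(μ′,s))·(w(μ,s′) − w(μ,s))` — the cross defect of the four one-cube partition functions is the PRODUCT of the source increment
  and (minus) the content increment;
* §8 the corners lie in the unit disc (`norm_actB_X₀_lt_one`, W41's `norm_term_le` ×2, `A_cst ≤ 1`), `exp E = 1 + w` there (W24's
  `exp_locE_cube`), and **`rebornMuPart_live`**: for every real source `0 < t ≤ 2` the mixed difference of `E` over `{0, t} × {0, 1}` — the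
  quantity PART 1's `rebornEnd_fires` bounds for `t ≤ μ₀ < 1` — is NOT zero: exponentiating `E₁₁ + E₀₀ = E₀₁ + E₁₀` would force the cross
  defect `−(cM r∕2)²·∫incr(t·r)·∫incr(r∕2) < 0` to vanish; closing `example` at the source `t = ½`: liveness ∧ PART 1's bound `K₀(64,8)`
  (`2·K₀·μ₀` at `μ₀ = ½`) ∧ the activity's mixed difference `= 0`.

HONEST FRAMING.  A DECIDED TOY ([folklore]; 0 sorry; 0 citations; no `def`): W33's Gaussian cores on NE5's toy frame, NOT Bałaban's (2.14)
densities; the separable placement and every numeral OURS; (B1a) discharged at the cores inside S56∕S33, (B1b) by construction, (B3) = `hM3` BY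
CHOICE (G-ne9p2-5 UNPRINTED), (B5)-KIND clauses; the μ-extension and the re-born-μ-part READING are the cell's, UNPRINTED ([Balaban1989LargeFieldII]
p. 356; C-t4r2-340 (n1)); the liveness is a statement about THIS toy's logarithm, NOT about Bałaban's densities; 0 binders instantiated on
Bałaban's densities; no wall item; wall v1.8 (T4-DAG v48; v49∕v50 verbatim) — words, not kind — does NOT move; R-t4r2-Q2 NOT met; NE1′ ⇐ the
named binders — NOT proved, NOT printed; spine PROVED 0∕9; count 9 unchanged.  Rung (B)+1 on ONE finite four-torus — NOT infinite volume,
NOT a mass gap, NOT OS on ℝ⁴, NOT Clay.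
HONEST DEPENDENCY: continuum YM on T⁴ ⇐ BetaPertH ∧ nine spine estimates (0/9 proved); BetaPertH ⇐ (D1) ∧ (D4) ∧ CAP+tail; G-an2-4
gates asym, D1 and NE2/3/4.
-/

noncomputable section

namespace Summit.QuantumFields.BalabanUV.T4Continuum.NE1p.DressedRebornMuPartSeparableWitness

open Set Metric MeasureTheory Complex
open scoped BigOperators
open Literature.MathematicalPhysics.QuantumFieldTheory.Balaban1983to89
open Literature.MathematicalPhysics.QuantumFieldTheory.Balaban1983to89.B12TreeDecay (K₀ K₀_pos)
open Literature.MathematicalPhysics.QuantumFieldTheory.Balaban1983to89.B13Resummation (locE)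
open Literature.MathematicalPhysics.QuantumFieldTheory.Balaban1983to89.TreeLengthTorus (TDom tsys)
open Literature.MathematicalPhysics.QuantumFieldTheory.Balaban1983to89.TreeLengthTorusGeometry (tgeometry TTouch)
open Summit.QuantumFields.BalabanUV.T4Continuum.B13HistMeasurable (B13HistM)
open Summit.QuantumFields.BalabanUV.T4Continuum.B13HistWitness (toyFrame)
open Summit.QuantumFields.BalabanUV.T4Continuum.B13TermParamGaussianBi (BiCore)
open Summit.QuantumFields.BalabanUV.T4Continuum.NE1p.DressedSmallFieldTorusWitness (X₀ X₀_val eq_X₀_iff dressedConst_le_one exp_locE_cube)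
open Summit.QuantumFields.BalabanUV.T4Continuum.NE1p.DressedSmallFieldCoresWitness (E1 crd Acst Acst_pos incr integral_incr_pos)
open Summit.QuantumFields.BalabanUV.T4Continuum.NE1p.DressedSmallFieldCoresMassWitness (cM cM_pos)
open Summit.QuantumFields.BalabanUV.T4Continuum.NE1p.DressedSmallFieldDepCoresWitness (termsD termsD_X₀ closedForm_real_sub_zero norm_term_le)

variable (r : ℝ) (hr : 0 ≤ r)

/-! ## §6 THE TWO TERMS IN CLOSED FORM ALONG THE BI-PENCIL: each core reads ONE of the two parameters -/

section Core
variable (c : ℝ)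

/-- **THE CORE AT `0` READS THE SOURCE ONLY**: `readOut p v (0 + μ • tab 0 + s • v_B) = μ·(r·e^{−(v 0)²})` (the read-out is ℂ-linear in the
table; `tab 0` is read, `tab 1` is not). [folklore] -/
theorem readOut_coreAt_zero_bipencil (p : Unit) (v : E1) (μ s : ℂ) :
    (coreAt 0 c r hr).readOut p v ((0 : B13HistM toyFrame) + μ • tab 0 + s • vB) = μ * ((r : ℂ) * (Real.exp (-(crd v ^ 2)) : ℂ)) := by
  unfold vB
  rw [map_add, map_add, map_zero, map_smul, map_smul, map_smul, readOut_coreAt_tab_self,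
    readOut_coreAt_tab_of_ne 0 c r hr p v (by norm_num : (0 : ℕ) ≠ 1)]
  simp only [smul_eq_mul, mul_zero, add_zero, zero_add]

/-- **THE CORE AT `1` READS THE CONTENT ONLY**: `readOut p v (0 + μ • tab 0 + s • v_B) = (s∕2)·(r·e^{−(v 0)²})`. [folklore] -/
theorem readOut_coreAt_one_bipencil (p : Unit) (v : E1) (μ s : ℂ) :
    (coreAt 1 c r hr).readOut p v ((0 : B13HistM toyFrame) + μ • tab 0 + s • vB) = s / 2 * ((r : ℂ) * (Real.exp (-(crd v ^ 2)) : ℂ)) := by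
  unfold vB
  rw [map_add, map_add, map_zero, map_smul, map_smul, map_smul, readOut_coreAt_tab_self,
    readOut_coreAt_tab_of_ne 1 c r hr p v (by norm_num : (1 : ℕ) ≠ 0)]
  simp only [smul_eq_mul, mul_zero, add_zero, zero_add]
  ring

/-- The term at domain `0` in CLOSED FORM: `c·∫ e^{μ·r·e^{−(v 0)²}}·e^{−‖v‖²} dv` — W41's integrand family at `τ = μ` (Dirac mass out, `chi = 1`,
`N = 1`). [folklore] -/
theorem termAt_coreAt_zero_bipencil (μ s : ℂ) :
    (coreAt 0 c r hr).termAt (0 : ℂ) ((0 : B13HistM toyFrame) + μ • tab 0 + s • vB) =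
      (c : ℂ) * ∫ v : E1, cexp (μ * ((r : ℂ) * (Real.exp (-(crd v ^ 2)) : ℂ))) * cexp (-(((‖v‖ ^ 2 : ℝ) : ℂ))) := by
  rw [BiCore.termAt]
  show ∫ p, (coreAt 0 c r hr).w p * (coreAt 0 c r hr).N 0 p *
      ∫ v, (coreAt 0 c r hr).chi v * cexp ((coreAt 0 c r hr).readOut p v (0 + μ • tab 0 + s • vB)) *
        cexp (-(coreAt 0 c r hr).q 0 p v) ∂volume ∂(coreAt 0 c r hr).lam = _
  simp_rw [chi_coreAt, readOut_coreAt_zero_bipencil, one_mul]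
  show ∫ p, (c : ℂ) * 1 * ∫ v, cexp (μ * ((r : ℂ) * (Real.exp (-(crd v ^ 2)) : ℂ))) *
      cexp (-(((‖v‖ ^ 2 : ℝ) : ℂ))) ∂volume ∂(Measure.dirac ()) = _
  rw [integral_dirac, mul_one]

/-- The term at domain `1` in CLOSED FORM: `c·∫ e^{(s∕2)·r·e^{−(v 0)²}}·e^{−‖v‖²} dv` — the same family at `τ = s∕2`. [folklore] -/
theorem termAt_coreAt_one_bipencil (μ s : ℂ) :
    (coreAt 1 c r hr).termAt (0 : ℂ) ((0 : B13HistM toyFrame) + μ • tab 0 + s • vB) =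
      (c : ℂ) * ∫ v : E1, cexp (s / 2 * ((r : ℂ) * (Real.exp (-(crd v ^ 2)) : ℂ))) * cexp (-(((‖v‖ ^ 2 : ℝ) : ℂ))) := by
  rw [BiCore.termAt]
  show ∫ p, (coreAt 1 c r hr).w p * (coreAt 1 c r hr).N 0 p *
      ∫ v, (coreAt 1 c r hr).chi v * cexp ((coreAt 1 c r hr).readOut p v (0 + μ • tab 0 + s • vB)) *
        cexp (-(coreAt 1 c r hr).q 0 p v) ∂volume ∂(coreAt 1 c r hr).lam = _
  simp_rw [chi_coreAt, readOut_coreAt_one_bipencil, one_mul]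
  show ∫ p, (c : ℂ) * 1 * ∫ v, cexp (s / 2 * ((r : ℂ) * (Real.exp (-(crd v ^ 2)) : ℂ))) *
      cexp (-(((‖v‖ ^ 2 : ℝ) : ℂ))) ∂volume ∂(Measure.dirac ()) = _
  rw [integral_dirac, mul_one]

end Core

section Torus
variable (N : ℕ) [NeZero N]

/-- **THE ACTIVITY AT THE CUBE IN CLOSED FORM**: `act(μ,s) X₀ = b(s) + a(μ)` with `b(s) = (cM r∕2)·∫ e^{(s∕2)·r·e^{−x²}}…` (the term at `1`) and
`a(μ) = (cM r∕2)·∫ e^{μ·r·e^{−x²}}…` (the term at `0`) — ADDITIVELY SEPARABLE in (source, content). [folklore] -/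
theorem actB_X₀ (k : ℕ) (μ s : ℂ) :
    actB r hr N k (μ, s) (X₀ N) =
      ((cM r / 2 : ℝ) : ℂ) * (∫ v : E1, cexp (s / 2 * ((r : ℂ) * (Real.exp (-(crd v ^ 2)) : ℂ))) * cexp (-(((‖v‖ ^ 2 : ℝ) : ℂ)))) +
        ((cM r / 2 : ℝ) : ℂ) * ∫ v : E1, cexp (μ * ((r : ℂ) * (Real.exp (-(crd v ^ 2)) : ℂ))) * cexp (-(((‖v‖ ^ 2 : ℝ) : ℂ))) := by
  unfold actB
  rw [termsD_X₀, Fintype.sum_bool, GB_true, GB_false]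
  dsimp only
  rw [termAt_coreAt_one_bipencil, termAt_coreAt_zero_bipencil]

/-- Off the cube every term is absent and the activity vanishes at every (source, content). [folklore] -/
theorem actB_of_ne (k : ℕ) (z : ℂ × ℂ) {Z : TDom 4 N} (hZ : Z.1 ≠ {0}) : actB r hr N k z Z = 0 := by
  unfold actB termsD; rw [if_neg hZ, Finset.sum_empty]

/-! ## §7 SEPARABILITY: the activity's mixed difference VANISHES; the two increments; the cross defect is their product -/

/-- **THE ACTIVITY's RE-BORN μ-PART VANISHES IDENTICALLY** [decided toy]: at EVERY polymer and for every two sources `μ, μ′` and contents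
`s, s′`, `act(μ,s) − act(μ′,s) − (act(μ,s′) − act(μ′,s′)) = 0` — each term reads ONE parameter. [folklore] -/
theorem actB_mixedDiff_eq_zero (k : ℕ) (μ μ' s s' : ℂ) (Z : TDom 4 N) :
    actB r hr N k (μ, s) Z - actB r hr N k (μ', s) Z - (actB r hr N k (μ, s') Z - actB r hr N k (μ', s') Z) = 0 := by
  by_cases hZ : Z.1 = {0}
  · rw [(eq_X₀_iff N Z).1 hZ, actB_X₀, actB_X₀, actB_X₀, actB_X₀]; ring
  · rw [actB_of_ne r hr N k _ hZ, actB_of_ne r hr N k _ hZ, actB_of_ne r hr N k _ hZ, actB_of_ne r hr N k _ hZ]; ring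

/-- **THE SOURCE INCREMENT** at a real source `t` (any content `s`): `act(t,s) X₀ − act(0,s) X₀ = (cM r∕2)·∫incr(t·r)` (W41's
`closedForm_real_sub_zero` BY NAME). [folklore] -/
theorem actB_source_incr (k : ℕ) (t : ℝ) (s : ℂ) :
    actB r hr N k ((t : ℂ), s) (X₀ N) - actB r hr N k (0, s) (X₀ N) = ((cM r / 2 : ℝ) : ℂ) * ((∫ v, incr (t * r) v : ℝ) : ℂ) := by
  rw [actB_X₀, actB_X₀, add_sub_add_left_eq_sub]
  exact closedForm_real_sub_zero _ r hr t

/-- **THE CONTENT INCREMENT** (any source `μ`): `act(μ,1) X₀ − act(μ,0) X₀ = (cM r∕2)·∫incr(r∕2)` — the content `v_B = ½ • tab 1` is read at half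
strength. [folklore] -/
theorem actB_content_incr (k : ℕ) (μ : ℂ) :
    actB r hr N k (μ, 1) (X₀ N) - actB r hr N k (μ, 0) (X₀ N) = ((cM r / 2 : ℝ) : ℂ) * ((∫ v, incr (1 / 2 * r) v : ℝ) : ℂ) := by
  rw [actB_X₀, actB_X₀, add_sub_add_right_eq_sub]
  have h := closedForm_real_sub_zero (cM r / 2) r hr (1 / 2)
  have hc : ((1 / 2 : ℝ) : ℂ) = 1 / 2 := by push_cast; ring
  rw [hc] at h
  simp only [zero_div]
  exact h

/-- **THE CROSS DEFECT IS THE PRODUCT OF THE TWO INCREMENTS** [arith on the separable closed form]: for the four one-cube activities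
`(1 + w(μ,s))(1 + w(μ′,s′)) − (1 + w(μ′,s))(1 + w(μ,s′)) = (w(μ,s) − w(μ′,s))·(w(μ,s′) − w(μ,s))`. [folklore] -/
theorem crossDefect_eq (k : ℕ) (μ μ' s s' : ℂ) :
    (1 + actB r hr N k (μ, s) (X₀ N)) * (1 + actB r hr N k (μ', s') (X₀ N)) -
        (1 + actB r hr N k (μ', s) (X₀ N)) * (1 + actB r hr N k (μ, s') (X₀ N)) =
      (actB r hr N k (μ, s) (X₀ N) - actB r hr N k (μ', s) (X₀ N)) * (actB r hr N k (μ, s') (X₀ N) - actB r hr N k (μ, s) (X₀ N)) := by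
  rw [actB_X₀, actB_X₀, actB_X₀, actB_X₀]; ring

/-! ## §8 THE CORNERS LIE IN THE UNIT DISC, `exp E = 1 + w` THERE, AND THE RE-BORN μ-PART OF `E` IS LIVE -/

/-- The activity at the cube lies STRICTLY inside the unit disc for `‖μ‖, ‖s‖ ≤ 2` (W41's `norm_term_le` per term, `A_cst ≤ 1`,
`√π∕√(2π) < 1`). [folklore] -/
theorem norm_actB_X₀_lt_one (k : ℕ) {μ s : ℂ} (hμ : ‖μ‖ ≤ 2) (hs : ‖s‖ ≤ 2) : ‖actB r hr N k (μ, s) (X₀ N)‖ < 1 := by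
  rw [actB_X₀]
  have hs2 : ‖s / 2‖ ≤ 2 := by rw [norm_div, Complex.norm_two]; linarith [norm_nonneg s]
  have h1 := norm_term_le r hr hs2
  have h2 := norm_term_le r hr hμ
  have hπ : 0 < Real.sqrt Real.pi := Real.sqrt_pos.2 Real.pi_pos
  have hlt : Real.sqrt Real.pi < Real.sqrt (2 * Real.pi) := Real.sqrt_lt_sqrt Real.pi_pos.le (by linarith [Real.pi_pos])
  have hq : Real.sqrt Real.pi / Real.sqrt (2 * Real.pi) < 1 := (div_lt_one (hπ.trans hlt)).2 hlt
  have hA : Acst ≤ 1 := dressedConst_le_one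
  have hA0 := Acst_pos
  calc _ ≤ _ := norm_add_le _ _
    _ ≤ Acst / 2 * (Real.sqrt Real.pi / Real.sqrt (2 * Real.pi)) + Acst / 2 * (Real.sqrt Real.pi / Real.sqrt (2 * Real.pi)) :=
        add_le_add h1 h2
    _ < 1 := by nlinarith

open Classical in
/-- **`exp E[act(μ,s)]({0}) = 1 + act(μ,s) X₀`** at every corner with `‖μ‖, ‖s‖ ≤ 2` (W24's `exp_locE_cube` BY NAME). [folklore] -/
theorem exp_locE_actB (k : ℕ) {μ s : ℂ} (hμ : ‖μ‖ ≤ 2) (hs : ‖s‖ ≤ 2) :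
    cexp (locE (TTouch (d := 4) (N := N)) (fun Z : (tsys 4 N).Dom => Z.1) (actB r hr N k (μ, s)) {0}) = 1 + actB r hr N k (μ, s) (X₀ N) :=
  exp_locE_cube N (norm_actB_X₀_lt_one r hr N k hμ hs)

open Classical in
/-- **THE RE-BORN μ-PART OF THE CLUSTER LOGARITHM IS LIVE** [decided toy]: for every real source `0 < t ≤ 2` (in particular on PART 1's window
`t ≤ μ₀ < 1`) the mixed difference `E(t,1) − E(0,1) − (E(t,0) − E(0,0))` of the dressed one-cube output is NOT zero — although the activity's
is (`actB_mixedDiff_eq_zero`): `E₁₁ + E₀₀ = E₀₁ + E₁₀` exponentiates (W24) to a vanishing cross defect, i.e. by `crossDefect_eq` to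
`(cM r∕2)·∫incr(t·r) · (−(cM r∕2)·∫incr(r∕2)) = 0`, and both increments are POSITIVE (W33's `integral_incr_pos`). [folklore] -/
theorem rebornMuPart_live (hr0 : 0 < r) (k : ℕ) {t : ℝ} (ht : 0 < t) (ht2 : t ≤ 2) :
    locE (tgeometry 4 N).ι (tgeometry 4 N).cubes (actB r hr N k ((t : ℂ), 1)) ((tgeometry 4 N).cubes (X₀ N)) -
          locE (tgeometry 4 N).ι (tgeometry 4 N).cubes (actB r hr N k (0, 1)) ((tgeometry 4 N).cubes (X₀ N)) -
        (locE (tgeometry 4 N).ι (tgeometry 4 N).cubes (actB r hr N k ((t : ℂ), 0)) ((tgeometry 4 N).cubes (X₀ N)) -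
          locE (tgeometry 4 N).ι (tgeometry 4 N).cubes (actB r hr N k (0, 0)) ((tgeometry 4 N).cubes (X₀ N))) ≠ 0 := by
  intro h
  have nt : ‖((t : ℝ) : ℂ)‖ ≤ 2 := by rw [Complex.norm_real, Real.norm_eq_abs, abs_of_pos ht]; exact ht2
  have n1 : ‖(1 : ℂ)‖ ≤ 2 := by rw [norm_one]; norm_num
  have n0 : ‖(0 : ℂ)‖ ≤ 2 := by rw [norm_zero]; norm_num
  have e11 := exp_locE_actB r hr N k nt n1
  have e01 := exp_locE_actB r hr N k n0 n1
  have e10 := exp_locE_actB r hr N k nt n0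
  have e00 := exp_locE_actB r hr N k n0 n0
  have h' : locE (TTouch (d := 4) (N := N)) (fun Z : (tsys 4 N).Dom => Z.1) (actB r hr N k ((t : ℂ), 1)) {0} -
        locE (TTouch (d := 4) (N := N)) (fun Z : (tsys 4 N).Dom => Z.1) (actB r hr N k (0, 1)) {0} -
      (locE (TTouch (d := 4) (N := N)) (fun Z : (tsys 4 N).Dom => Z.1) (actB r hr N k ((t : ℂ), 0)) {0} -
        locE (TTouch (d := 4) (N := N)) (fun Z : (tsys 4 N).Dom => Z.1) (actB r hr N k (0, 0)) {0}) = 0 := h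
  have hsum : locE (TTouch (d := 4) (N := N)) (fun Z : (tsys 4 N).Dom => Z.1) (actB r hr N k ((t : ℂ), 1)) {0} +
        locE (TTouch (d := 4) (N := N)) (fun Z : (tsys 4 N).Dom => Z.1) (actB r hr N k (0, 0)) {0} =
      locE (TTouch (d := 4) (N := N)) (fun Z : (tsys 4 N).Dom => Z.1) (actB r hr N k (0, 1)) {0} +
        locE (TTouch (d := 4) (N := N)) (fun Z : (tsys 4 N).Dom => Z.1) (actB r hr N k ((t : ℂ), 0)) {0} := by
    linear_combination h'
  have hexp := congrArg cexp hsum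
  rw [Complex.exp_add, Complex.exp_add, e11, e00, e01, e10] at hexp
  -- the cross defect vanishes, hence the product of the two increments does
  have hdef := crossDefect_eq r hr N k (t : ℂ) 0 1 0
  rw [hexp, sub_self, actB_source_incr, ← neg_sub, actB_content_incr] at hdef
  have hc : ((cM r / 2 : ℝ) : ℂ) ≠ 0 := by exact_mod_cast (half_pos (cM_pos r)).ne'
  have hX : ((∫ v, incr (t * r) v : ℝ) : ℂ) ≠ 0 := by exact_mod_cast (integral_incr_pos (t * r) (mul_pos ht hr0)).ne'
  have hY : ((∫ v, incr (1 / 2 * r) v : ℝ) : ℂ) ≠ 0 := by exact_mod_cast (integral_incr_pos (1 / 2 * r) (by positivity)).ne'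
  exact mul_ne_zero (mul_ne_zero hc hX) (neg_ne_zero.2 (mul_ne_zero hc hY)) hdef.symm

open Classical in
/-- **BOTH STATEMENTS ON THE SAME DATUM AT THE SOURCE `t = ½`** (window `μ₀ = ½`): the re-born μ-part of `E` is NOT zero ∧ PART 1's END bounds
it by `2·K₀(64,8)·½ = K₀(64,8)`-type constant `2·K₀(64,8)·μ₀` ∧ the activity's own re-born μ-part IS zero — every `N`, `r > 0`, `k`. [folklore] -/
example (hr0 : 0 < r) (k : ℕ) :
    locE (tgeometry 4 N).ι (tgeometry 4 N).cubes (actB r hr N k ((((1 / 2 : ℝ)) : ℂ), 1)) ((tgeometry 4 N).cubes (X₀ N)) -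
            locE (tgeometry 4 N).ι (tgeometry 4 N).cubes (actB r hr N k (0, 1)) ((tgeometry 4 N).cubes (X₀ N)) -
          (locE (tgeometry 4 N).ι (tgeometry 4 N).cubes (actB r hr N k ((((1 / 2 : ℝ)) : ℂ), 0)) ((tgeometry 4 N).cubes (X₀ N)) -
            locE (tgeometry 4 N).ι (tgeometry 4 N).cubes (actB r hr N k (0, 0)) ((tgeometry 4 N).cubes (X₀ N))) ≠ 0 ∧
      ‖locE (tgeometry 4 N).ι (tgeometry 4 N).cubes (actB r hr N k ((((1 / 2 : ℝ)) : ℂ), 1)) ((tgeometry 4 N).cubes (X₀ N)) -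
            locE (tgeometry 4 N).ι (tgeometry 4 N).cubes (actB r hr N k (0, 1)) ((tgeometry 4 N).cubes (X₀ N)) -
          (locE (tgeometry 4 N).ι (tgeometry 4 N).cubes (actB r hr N k ((((1 / 2 : ℝ)) : ℂ), 0)) ((tgeometry 4 N).cubes (X₀ N)) -
            locE (tgeometry 4 N).ι (tgeometry 4 N).cubes (actB r hr N k (0, 0)) ((tgeometry 4 N).cubes (X₀ N)))‖ ≤
        2 * K₀ 64 8 * (1 / 2) ∧
      actB r hr N k ((((1 / 2 : ℝ)) : ℂ), 1) (X₀ N) - actB r hr N k (0, 1) (X₀ N) -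
          (actB r hr N k ((((1 / 2 : ℝ)) : ℂ), 0) (X₀ N) - actB r hr N k (0, 0) (X₀ N)) = 0 :=
  ⟨rebornMuPart_live r hr N hr0 k (t := 1 / 2) (by norm_num) (by norm_num),
    rebornEnd_fires_unit_content r hr N hr0 k (μ₀ := 1 / 2) (by norm_num) (by norm_num)
      (by rw [Complex.norm_real, Real.norm_eq_abs]; norm_num),
    actB_mixedDiff_eq_zero r hr N k _ _ _ _ _⟩

end Torus

end Summit.QuantumFields.BalabanUV.T4Continuum.NE1p.DressedRebornMuPartSeparableWitness

end
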